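import Literature.Topology.FourManifolds.ThinHandleFunction
import HarnessLib

/-!
# The thin-handle function with its transversality clauses exposed
# (Milnor 1963, proof of Thm. 3.2, Assertions 1–3)

Topic `Literature/Topology/FourManifolds` (Morse theory); infrastructure for the fact seat
`provefact-Literature.Geometry.Riemannian.LawsonMichelsohn1984_surrounding` (Lawson–Michelsohn
1984, Thm. 6.1: the sublevel handlebody of a `1`-thin domain of `ℝ^{m+1}` is swept, critical
level by critical level, onto mean-convex domains; at a critical level the passage
`M^{c-ε} ↝ M^{c+ε}` is read through Milnor's modified function `F = f - μ(ξ + K η)` of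
`ThinHandleFunction.lean`, and the comparison of the thin handlebody `{F ≤ c - ε}` with the
mean-convex domain built around the descending discs is a *regular one-parameter family of
defining functions* (`RegularFamilyIsotopy.lean`), whose regularity is certified by a common
transversal vector: Milnor's model field `(-x⃗, y⃗)` in the charts).  Everything here is
**proved**; no definitions, no named facts.

* `fderiv_thinHandleModel_cone_pos` — in the model, the derivative of
  `c - ξ + η - μ(ξ + K η)` on `a(-x⃗, y⃗) + b(0, 2y⃗)` (`a, b ≥ 0`; `(-x⃗, y⃗)` is Milnor's field
  `milnorModelField`) is `2aξ(1 + μ') + 2(a + 2b)η(1 - K μ') > 0` as soon as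
  `aξ + (a + 2b)η > 0` (`-1 < μ' ≤ 0`, `K ≥ 0`): **every level set of the model is transverse to
  this cone of fields** (Milnor 1963, proof of Thm. 3.2, Assertion 2, which is the case of the
  zero vector).
* `exists_thinHandleFunction'` — the tree's `exists_thinHandleFunction` (Milnor's Assertions 1–3,
  thin form, at finitely many critical points of one level) with two more clauses recorded from
  the same construction `F = f - Σ_p μ(ξ + K η) ∘ e_p`:
  (T5) in each closed chart ball, `d(F ∘ e_p⁻¹)(y)(a(-x⃗, y⃗) + b(0, 2y⃗)) > 0` for `a, b ≥ 0`
  with `aξ + (a + 2b)η > 0`;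
  (T6) wherever `F x = f x` the differentials agree, `dF_x = df_x` (the correction
  `Σ_p μ(…) ≥ 0` vanishes at `x`, so `x` is a minimum of it and its differential vanishes —
  Fermat).

## References

* J. Milnor, *Morse theory*, Ann. of Math. Studies 51 (1963), Thm. 3.2 and its proof
  (pp. 14–17). [Milnor1963]
* H. B. Lawson, Jr., M.-L. Michelsohn, *Embedding and surrounding with positive mean curvature*,
  Invent. Math. 77 (1984) 399–419, Thm. 6.1 (the consumer). [LawsonMichelsohn1984]
-/

open scoped Manifold ContDiff Topology
open Set Function Filter Metric

noncomputable section

namespace Literature.Topology.FourManifolds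

/-! ### The model: transversality of the level sets to Milnor's field -/

section Model

variable {n : ℕ}

/-- **The level sets of the model thin-handle function are transverse to the cone of fields
`a (-x⃗, y⃗) + b (0, 2y⃗)`** (`a, b ≥ 0`): for `K ≥ 0`,
`d(c - ξ + η - μ(ξ + K η))(y)(a(-x⃗, y⃗) + b(0, 2y⃗)) = 2aξ(1 + μ') + 2(a + 2b)η(1 - K μ')`,
which is `> 0` as soon as `aξ + (a + 2b)η > 0` (`-1 < μ' ≤ 0`).  Milnor's Assertion 2 is the
case of the zero vector; `(a, b) = (1, 0)` is Milnor's field, `(0, 1)` the pure expansion of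
`y⃗`. [cite: Milnor1963, Thm. 3.2 (proof, Assertion 2)] -/
theorem fderiv_thinHandleModel_cone_pos {k : ℕ} {c ε K : ℝ} (hK : 0 ≤ K)
    (y : EuclideanSpace ℝ (Fin n)) {a b : ℝ} (ha : 0 ≤ a) (hb : 0 ≤ b)
    (hpos : 0 < a * sqSumLT k y + (a + 2 * b) * sqSumGE k y) :
    0 < fderiv ℝ (thinHandleModel (n := n) k c ε K) y
      (a • milnorModelField k y + b • (y + milnorModelField k y)) := by
  classical
  set ST := Finset.univ.filter (fun i : Fin n => (i : ℕ) < k) with hST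
  set SN := Finset.univ.filter (fun i : Fin n => k ≤ (i : ℕ)) with hSN
  set Lξ : EuclideanSpace ℝ (Fin n) →L[ℝ] ℝ := ∑ i ∈ ST, (2 * y i) • (EuclideanSpace.proj (𝕜 := ℝ) i) with hLξ
  set Lη : EuclideanSpace ℝ (Fin n) →L[ℝ] ℝ := ∑ i ∈ SN, (2 * y i) • (EuclideanSpace.proj (𝕜 := ℝ) i) with hLη
  have hξ : HasFDerivAt (sqSumLT (m := n) k) Lξ y := hasFDerivAt_sum_sq ST y
  have hη : HasFDerivAt (sqSumGE (m := n) k) Lη y := hasFDerivAt_sum_sq SN y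
  set q := sqSumLT k y + K * sqSumGE k y with hq
  set m := deriv (handleProfile ε) q with hm
  have hin : HasFDerivAt (fun y : EuclideanSpace ℝ (Fin n) => sqSumLT k y + K * sqSumGE k y)
      (Lξ + K • Lη) y :=
    hξ.add (hη.const_mul K) |>.congr_fderiv (by ext v; simp [smul_eq_mul])
  have hout : HasDerivAt (handleProfile ε) m q :=
    (hasDerivAt_handleProfile ε q).differentiableAt.hasDerivAt
  have hμ : HasFDerivAt ((handleProfile ε) ∘ fun y : EuclideanSpace ℝ (Fin n) =>
      sqSumLT k y + K * sqSumGE k y) (m • (Lξ + K • Lη)) y :=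
    hout.comp_hasFDerivAt y hin
  have hF : HasFDerivAt (thinHandleModel (n := n) k c ε K)
      ((0 : EuclideanSpace ℝ (Fin n) →L[ℝ] ℝ) - Lξ + Lη - m • (Lξ + K • Lη)) y := by
    unfold thinHandleModel
    exact (((hasFDerivAt_const c y).sub hξ).add hη).sub hμ
  rw [hF.fderiv]
  set D : EuclideanSpace ℝ (Fin n) →L[ℝ] ℝ :=
    (0 : EuclideanSpace ℝ (Fin n) →L[ℝ] ℝ) - Lξ + Lη - m • (Lξ + K • Lη) with hD
  have hDapp : ∀ v, D v = 0 - Lξ v + Lη v - m * (Lξ v + K * Lη v) := fun v => rfl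
  have h1 : Lξ (milnorModelField k y) = -2 * sqSumLT k y := fderiv_sqSumLT_milnorModelField k y
  have h2 : Lη (milnorModelField k y) = 2 * sqSumGE k y := fderiv_sqSumGE_milnorModelField k y
  have h3 : Lξ y = 2 * sqSumLT k y := by
    simp only [hLξ, FunLike.coe_sum, Finset.sum_apply, FunLike.coe_smul, Pi.smul_apply,
      EuclideanSpace.coe_proj, smul_eq_mul, sqSumLT, Finset.mul_sum]
    exact Finset.sum_congr rfl fun i _ => by ring
  have h4 : Lη y = 2 * sqSumGE k y := by
    simp only [hLη, FunLike.coe_sum, Finset.sum_apply, FunLike.coe_smul, Pi.smul_apply,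
      EuclideanSpace.coe_proj, smul_eq_mul, sqSumGE, Finset.mul_sum]
    exact Finset.sum_congr rfl fun i _ => by ring
  have hDmv : D (milnorModelField k y) =
      2 * sqSumLT k y * (1 + m) + 2 * sqSumGE k y * (1 - K * m) := by
    rw [hDapp, h1, h2]; ring
  have hDy : D y = -(2 * sqSumLT k y * (1 + m)) + 2 * sqSumGE k y * (1 - K * m) := by
    rw [hDapp, h3, h4]; ring
  have hval : D (a • milnorModelField k y + b • (y + milnorModelField k y)) =
      2 * a * sqSumLT k y * (1 + m) + 2 * (a + 2 * b) * sqSumGE k y * (1 - K * m) := by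
    rw [map_add, map_smul, map_smul, map_add, hDmv, hDy, smul_eq_mul, smul_eq_mul]; ring
  rw [hval]
  have hmI := deriv_handleProfile_mem_Icc ε q
  rw [← hm] at hmI
  have hξ0 := sqSumLT_nonneg k y
  have hη0 := sqSumGE_nonneg k y
  have h1m : 0 < 1 + m := by linarith [hmI.1]
  have h2m : 1 ≤ 1 - K * m := by nlinarith [hmI.2, hK]
  have hA : 0 ≤ 2 * a * sqSumLT k y * (1 + m) := by positivity
  have hB : 2 * (a + 2 * b) * sqSumGE k y ≤ 2 * (a + 2 * b) * sqSumGE k y * (1 - K * m) := by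
    have : 0 ≤ 2 * (a + 2 * b) * sqSumGE k y := by positivity
    nlinarith
  -- either `a ξ > 0` (then the first term is positive) or `(a + 2b) η > 0`
  rcases (mul_nonneg ha hξ0).lt_or_eq with hax | hax
  · have : 0 < 2 * a * sqSumLT k y * (1 + m) := by
      have := mul_pos hax h1m; linarith
    nlinarith [mul_nonneg (by positivity : (0 : ℝ) ≤ 2 * (a + 2 * b)) hη0]
  · have hbη : 0 < (a + 2 * b) * sqSumGE k y := by rw [← hax] at hpos; linarith
    nlinarith

end Model

/-! ### The thin-handle function with the clauses (T5), (T6) -/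

section Manifold

variable {n : ℕ} {M : Type*} [TopologicalSpace M] [ChartedSpace (EuclideanSpace ℝ (Fin n)) M]
  [IsManifold (𝓡 n) ∞ M] [T2Space M]

/-- **The thin-handle function, with transversality clauses** (Milnor 1963, proof of Thm. 3.2,
Assertions 1–3, thin form; the tree's `exists_thinHandleFunction` verbatim, plus (T5), (T6)).
Let `f` be smooth on the `C^∞` manifold `M` (Hausdorff), `c` a level, `0 < ε`, `0 < R` with
`2ε ≤ R²`, and `P` a finite set of points with pairwise disjoint Morse charts `e_p` of the
maximal atlas (`e_p p = 0`, `B̄(0, R) ⊆ e_p.target`, `f ∘ e_p⁻¹ = c - ξ + η` on the target,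
index `λ_p`); let `N` be an open set containing `M^{c-ε}` and the descending discs
`e_p⁻¹{η = 0, ξ ≤ ε}`.  Then there is a `C^∞` function `F` with: `F ≤ f ≤ F + 2ε`;
`F ≤ c + ε ⟹ f ≤ c + ε`; `{F ≤ c - ε} ⊆ N`; `F = f` off the chart balls; `F(p) ≤ c - 5ε/4` on
`P`; every critical point of `F` outside `P` is a critical point of `f` with `F = f` there;
**(T5)** for `p ∈ P`, `y ∈ B̄(0, R)`, `a, b ≥ 0` with `aξ(y) + (a + 2b)η(y) > 0`:
`0 < d(F ∘ e_p⁻¹)(y)(a(-x⃗, y⃗) + b(0, 2y⃗))` (all level sets of `F` in the chart balls are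
transverse to this cone of fields); **(T6)** `F x = f x ⟹ dF_x = df_x`.
[cite: Milnor1963, Thm. 3.2 (proof)] -/
theorem exists_thinHandleFunction' {f : M → ℝ} (hf : ContMDiff (𝓡 n) 𝓘(ℝ, ℝ) ∞ f) {c ε R : ℝ}
    (hε : 0 < ε) (hR : 0 < R) (hRε : 2 * ε ≤ R ^ 2) (P : Finset M) (lam : M → ℕ)
    (e : M → OpenPartialHomeomorph M (EuclideanSpace ℝ (Fin n)))
    (he : ∀ p ∈ P, e p ∈ IsManifold.maximalAtlas (𝓡 n) ∞ M)
    (hpe : ∀ p ∈ P, p ∈ (e p).source ∧ e p p = 0)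
    (hball : ∀ p ∈ P, closedBall (0 : EuclideanSpace ℝ (Fin n)) R ⊆ (e p).target)
    (hquad : ∀ p ∈ P, ∀ y ∈ (e p).target,
      f ((e p).symm y) = c - sqSumLT (lam p) y + sqSumGE (lam p) y)
    (hdisj : ∀ p ∈ P, ∀ p' ∈ P, p ≠ p' →
      Disjoint ((e p).symm '' closedBall (0 : EuclideanSpace ℝ (Fin n)) R) ((e p').symm '' closedBall (0 : EuclideanSpace ℝ (Fin n)) R))
    {N : Set M} (hN : IsOpen N) (hNf : f ⁻¹' Iic (c - ε) ⊆ N)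
    (hND : ∀ p ∈ P, ∀ y : EuclideanSpace ℝ (Fin n), (∀ i : Fin n, lam p ≤ i.val → y i = 0) →
      sqSumLT (lam p) y ≤ ε → (e p).symm y ∈ N) :
    ∃ F : M → ℝ, ContMDiff (𝓡 n) 𝓘(ℝ, ℝ) ∞ F ∧ (∀ x, F x ≤ f x) ∧ (∀ x, f x ≤ F x + 2 * ε) ∧
      (∀ x, F x ≤ c + ε → f x ≤ c + ε) ∧ F ⁻¹' Iic (c - ε) ⊆ N ∧
      (∀ x, (∀ p ∈ P, x ∉ (e p).symm '' closedBall (0 : EuclideanSpace ℝ (Fin n)) R) → F x = f x) ∧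
      (∀ p ∈ P, F p ≤ c - 5 / 4 * ε) ∧
      (∀ x, IsMCriticalPt (𝓡 n) F x → x ∉ P → IsMCriticalPt (𝓡 n) f x ∧ F x = f x) ∧
      (∀ p ∈ P, ∀ y ∈ closedBall (0 : EuclideanSpace ℝ (Fin n)) R, ∀ a b : ℝ, 0 ≤ a → 0 ≤ b →
        0 < a * sqSumLT (lam p) y + (a + 2 * b) * sqSumGE (lam p) y →
        0 < fderiv ℝ (F ∘ (e p).symm) y
          (a • milnorModelField (lam p) y + b • (y + milnorModelField (lam p) y))) ∧
      (∀ x, F x = f x → mfderiv (𝓡 n) 𝓘(ℝ, ℝ) F x = mfderiv (𝓡 n) 𝓘(ℝ, ℝ) f x) := by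
  classical
  -- Step 0: the compact sets `Q_p` (disc ∪ sublevel part of the closed chart ball), margins `θ_p`
  have hθ : ∀ p ∈ P, ∃ θ : ℝ, 0 < θ ∧ ∀ y : EuclideanSpace ℝ (Fin n), ‖y‖ < R →
      (∃ y' : EuclideanSpace ℝ (Fin n), ‖y'‖ ≤ R ∧ dist y y' < θ ∧
        (((∀ i : Fin n, lam p ≤ i.val → y' i = 0) ∧ sqSumLT (lam p) y' ≤ ε) ∨
          f ((e p).symm y') ≤ c - ε)) → (e p).symm y ∈ N := by
    intro p hp
    set Q : Set (EuclideanSpace ℝ (Fin n)) := (closedBall 0 R ∩ {y | (∀ i : Fin n, lam p ≤ i.val → y i = 0) ∧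
        sqSumLT (lam p) y ≤ ε}) ∪ (closedBall 0 R ∩ (fun y => f ((e p).symm y)) ⁻¹' Iic (c - ε))
      with hQ
    set V : Set (EuclideanSpace ℝ (Fin n)) := (e p).target ∩ (e p).symm ⁻¹' N with hV
    have hVo : IsOpen V := (e p).continuousOn_symm.isOpen_inter_preimage (e p).open_target hN
    have hQc : IsCompact Q := by
      refine ((isCompact_closedBall _ _).inter_right ?_).union
        ((isCompact_closedBall (0 : EuclideanSpace ℝ (Fin n)) R).of_isClosed_subset ?_ inter_subset_left)
      · have h1 : IsClosed {y : EuclideanSpace ℝ (Fin n) | ∀ i : Fin n, lam p ≤ i.val → y i = 0} := by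
          have : {y : EuclideanSpace ℝ (Fin n) | ∀ i : Fin n, lam p ≤ i.val → y i = 0} =
              ⋂ i ∈ (Finset.univ.filter fun i : Fin n => lam p ≤ i.val), {y : EuclideanSpace ℝ (Fin n) | y i = 0} := by
            ext y; simp
          rw [this]
          exact isClosed_biInter fun i _ =>
            isClosed_eq (EuclideanSpace.proj (𝕜 := ℝ) i).continuous continuous_const
        exact h1.inter (isClosed_le (continuous_sqSumLT _) continuous_const)
      · exact (hf.continuous.comp_continuousOn ((e p).continuousOn_symm.mono (hball p hp)))
          |>.preimage_isClosed_of_isClosed isClosed_closedBall isClosed_Iic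
    have hQV : Q ⊆ V := by
      rintro y (⟨hyR, hpl, hξ⟩ | ⟨hyR, hyf⟩)
      · exact ⟨hball p hp hyR, hND p hp y hpl hξ⟩
      · exact ⟨hball p hp hyR, hNf hyf⟩
    obtain ⟨θ, hθpos, hθsub⟩ := hQc.exists_cthickening_subset_open hVo hQV
    refine ⟨θ, hθpos, fun y hyR ⟨y', hy'R, hdist, hy'⟩ => ?_⟩
    have hy'Q : y' ∈ Q := by
      rcases hy' with h | h
      · exact Or.inl ⟨mem_closedBall_zero_iff.2 hy'R, h⟩
      · exact Or.inr ⟨mem_closedBall_zero_iff.2 hy'R, h⟩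
    have hyV : y ∈ V :=
      hθsub (thickening_subset_cthickening θ Q (mem_thickening_iff.2 ⟨y', hy'Q, hdist⟩))
    exact hyV.2
  choose! θ hθpos hθN using hθ
  -- Step 1: the constant `K` and the function `F`
  set K : ℝ := 2 + ∑ p ∈ P, 2 * ε / θ p ^ 2 with hK
  have hK2 : 2 ≤ K := by
    rw [hK]
    have : 0 ≤ ∑ p ∈ P, 2 * ε / θ p ^ 2 :=
      Finset.sum_nonneg fun p hp => div_nonneg (by linarith) (sq_nonneg _)
    linarith
  have hK1 : 1 ≤ K := by linarith
  have hK0 : 0 ≤ K := by linarith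
  have hKθ : ∀ p ∈ P, 2 * ε / K ≤ θ p ^ 2 := by
    intro p hp
    have hθ2 : 0 < θ p ^ 2 := pow_pos (hθpos p hp) 2
    have hle : 2 * ε / θ p ^ 2 ≤ K := by
      rw [hK]
      have := Finset.single_le_sum (f := fun p => 2 * ε / θ p ^ 2)
        (fun p _ => div_nonneg (by linarith) (sq_nonneg _)) hp
      linarith
    rw [div_le_iff₀ (by linarith : (0 : ℝ) < K)]
    rw [div_le_iff₀ hθ2] at hle
    linarith
  set T : M → M → ℝ := fun p x => handleTerm (e p) (lam p) ε K x with hT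
  set S : M → ℝ := fun x => ∑ p ∈ P, T p x with hS
  set F : M → ℝ := fun x => f x - S x with hF
  -- the closed chart balls
  set B : M → Set M := fun p => (e p).symm '' closedBall (0 : EuclideanSpace ℝ (Fin n)) R with hB
  have hBc : ∀ p ∈ P, IsClosed (B p) ∧ B p ⊆ (e p).source := fun p hp =>
    ⟨(isCompact_symm_image_closedBall (hball p hp)).2.1,
      (isCompact_symm_image_closedBall (hball p hp)).2.2⟩
  -- Step 2: at most one term is nonzero at each point
  have hT0 : ∀ p ∈ P, ∀ x, x ∉ B p → T p x = 0 := fun p hp x hx =>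
    handleTerm_eq_zero_of_not_mem hε hK1 hR hRε hx
  have hTmem : ∀ p ∈ P, ∀ x, T p x ≠ 0 → x ∈ B p := fun p hp x hx => by
    by_contra h; exact hx (hT0 p hp x h)
  have hsum : ∀ x, (S x = 0) ∨ ∃ p ∈ P, S x = T p x ∧ T p x ≠ 0 := by
    intro x
    by_cases h : ∃ p ∈ P, T p x ≠ 0
    · obtain ⟨p, hp, hpx⟩ := h
      refine Or.inr ⟨p, hp, Finset.sum_eq_single p (fun p' hp' hne => ?_) (fun h => absurd hp h), hpx⟩
      by_contra hne'
      have h1 := hTmem p hp x hpx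
      have h2 := hTmem p' hp' x hne'
      exact Set.disjoint_left.1 (hdisj p hp p' hp' (Ne.symm hne)) h1 h2
    · push Not at h
      exact Or.inl (Finset.sum_eq_zero h)
  have hsum_nonneg : ∀ x, 0 ≤ S x := fun x =>
    Finset.sum_nonneg fun p _ => handleTerm_nonneg hε x
  have hsum_le : ∀ x, S x ≤ 2 * ε := fun x => by
    rcases hsum x with h | ⟨p, hp, h, -⟩
    · rw [h]; linarith
    · rw [h]; linarith [handleTerm_le (e := e p) (k := lam p) (K := K) hε hK0 x]
  -- in a chart: the values of `f`
  have hfval : ∀ p ∈ P, ∀ x ∈ (e p).source,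
      f x = c - sqSumLT (lam p) (e p x) + sqSumGE (lam p) (e p x) := fun p hp x hx => by
    conv_lhs => rw [← (e p).left_inv hx]
    exact hquad p hp _ ((e p).map_source hx)
  -- smoothness of `F`
  have hTsm : ∀ p ∈ P, ContMDiff (𝓡 n) 𝓘(ℝ, ℝ) ∞ (T p) := fun p hp =>
    contMDiff_handleTerm (he p hp) hε hK1 hR hRε (hball p hp)
  have hsumsm : ∀ S' : Finset M, S' ⊆ P → ContMDiff (𝓡 n) 𝓘(ℝ, ℝ) ∞ fun x => ∑ p ∈ S', T p x := by
    intro S' hS'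
    induction S' using Finset.induction_on with
    | empty => simpa using contMDiff_const
    | insert a S' ha ih =>
      have h1 := hTsm a (hS' (Finset.mem_insert_self a S'))
      have h2 := ih (fun p hp => hS' (Finset.mem_insert_of_mem hp))
      have h3 : (fun x => ∑ p ∈ insert a S', T p x) = fun x => T a x + ∑ p ∈ S', T p x :=
        funext fun x => Finset.sum_insert ha
      rw [h3]
      exact h1.add h2
  have hSsm : ContMDiff (𝓡 n) 𝓘(ℝ, ℝ) ∞ S := hsumsm P subset_rfl
  have hFsm : ContMDiff (𝓡 n) 𝓘(ℝ, ℝ) ∞ F := hf.sub hSsm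
  -- in a chart ball, off the other balls, `F` is the model read in the chart
  set O : M → Set M := fun p => (e p).source ∩ (⋃ p' ∈ P.erase p, B p')ᶜ with hO
  have hOo : ∀ p ∈ P, IsOpen (O p) := fun p hp =>
    (e p).open_source.inter
      (isClosed_biUnion_finset fun p' hp' => (hBc p' (Finset.mem_of_mem_erase hp')).1).isOpen_compl
  have hBO : ∀ p ∈ P, B p ⊆ O p := by
    intro p hp x hxBp
    refine ⟨(hBc p hp).2 hxBp, fun hx' => ?_⟩
    obtain ⟨p', hp', hxp'⟩ := mem_iUnion₂.1 hx'
    have hne : p' ≠ p := Finset.ne_of_mem_erase hp'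
    exact Set.disjoint_left.1 (hdisj p hp p' (Finset.mem_of_mem_erase hp') hne.symm) hxBp hxp'
  have hFO : ∀ p ∈ P, ∀ z ∈ O p, F z = thinHandleModel (lam p) c ε K (e p z) := by
    intro p hp z hz
    have hsum' : S z = T p z := by
      refine Finset.sum_eq_single p (fun p' hp' hne => hT0 p' hp' z fun h => hz.2 ?_)
        (fun h => absurd hp h)
      exact mem_iUnion₂.2 ⟨p', Finset.mem_erase.2 ⟨hne, hp'⟩, h⟩
    show f z - S z = _
    rw [hsum', hfval p hp z hz.1]
    show _ - handleTerm (e p) (lam p) ε K z = _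
    rw [handleTerm_of_mem hz.1, thinHandleModel]
  refine ⟨F, hFsm, fun x => ?_, fun x => ?_, fun x hx => ?_, fun x hx => ?_, fun x hx => ?_,
    fun p hp => ?_, fun x hxc hxP => ?_, fun p hp y hy a b ha hb hab => ?_, fun x hx => ?_⟩
  · -- `F ≤ f`
    show f x - S x ≤ f x
    linarith [hsum_nonneg x]
  · -- `f ≤ F + 2ε`
    show f x ≤ f x - S x + 2 * ε
    linarith [hsum_le x]
  · -- `{F ≤ c + ε} ⊆ {f ≤ c + ε}`
    change f x - S x ≤ c + ε at hx
    rcases hsum x with h | ⟨p, hp, h, hne⟩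
    · rw [h] at hx; linarith
    · obtain ⟨hxs, hq, -, -⟩ := mem_of_handleTerm_ne_zero hε hK1 hR hRε hne
      have hξ := sqSumLT_nonneg (lam p) (e p x)
      have hη := sqSumGE_nonneg (lam p) (e p x)
      have hη1 : sqSumGE (lam p) (e p x) ≤ ε := by
        by_contra hlt
        rw [not_le] at hlt
        nlinarith
      rw [hfval p hp x hxs]
      linarith
  · -- `{F ≤ c - ε} ⊆ N`
    change f x - S x ≤ c - ε at hx
    rcases hsum x with h | ⟨p, hp, h, hne⟩
    · rw [h, sub_zero] at hx
      exact hNf hx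
    · obtain ⟨hxs, hq, hnormR, -⟩ := mem_of_handleTerm_ne_zero hε hK1 hR hRε hne
      set y := e p x with hy
      have hξ := sqSumLT_nonneg (lam p) y
      have hη := sqSumGE_nonneg (lam p) y
      have hηK : sqSumGE (lam p) y < θ p ^ 2 := by
        have h1 : K * sqSumGE (lam p) y < 2 * ε := by linarith
        have h2 := hKθ p hp
        have hKpos : (0 : ℝ) < K := by linarith
        rw [div_le_iff₀ hKpos] at h2
        nlinarith
      obtain ⟨yT, hplane, hξT, hηT, hdist, hnormT⟩ := exists_planeProj (lam p) y
      have hmem : (e p).symm y ∈ N := by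
        refine hθN p hp y hnormR ⟨yT, by linarith, ?_, ?_⟩
        · rw [dist_eq_norm]
          exact lt_of_pow_lt_pow_left₀ 2 (hθpos p hp).le (by rw [hdist]; exact hηK)
        · by_cases hξε : sqSumLT (lam p) y ≤ ε
          · exact Or.inl ⟨hplane, by rw [hξT]; exact hξε⟩
          · right
            have hyT : yT ∈ (e p).target := hball p hp (mem_closedBall_zero_iff.2 (by linarith))
            rw [hquad p hp yT hyT, hξT, hηT]
            push Not at hξε
            linarith
      rwa [hy, (e p).left_inv hxs] at hmem
  · -- `F = f` off the chart balls
    show f x - S x = f x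
    rw [show S x = 0 from Finset.sum_eq_zero fun p hp => hT0 p hp x (hx p hp), sub_zero]
  · -- `F p ≤ c - 5ε/4`
    obtain ⟨hps, hp0⟩ := hpe p hp
    show f p - S p ≤ c - 5 / 4 * ε
    have hfp : f p = c := by
      rw [hfval p hp p hps, hp0]
      simp [sqSumLT, sqSumGE]
    have hTp : T p p = handleProfile ε 0 := by
      show handleTerm (e p) (lam p) ε K p = _
      rw [handleTerm_of_mem hps, hp0]
      simp [sqSumLT, sqSumGE]
    have hge : T p p ≤ S p :=
      Finset.single_le_sum (f := fun p' => T p' p) (fun p' _ => handleTerm_nonneg hε p) hp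
    have := le_handleProfile_zero hε
    linarith
  · -- critical points of `F` outside `P`
    by_cases hxB : ∃ p ∈ P, x ∈ B p
    · -- inside a chart ball: `F` is the model, whose only critical point is the centre
      exfalso
      obtain ⟨p, hp, hxBp⟩ := hxB
      have hxs : x ∈ (e p).source := (hBc p hp).2 hxBp
      have hxO : x ∈ O p := hBO p hp hxBp
      have hev : F =ᶠ[𝓝 x] fun z => thinHandleModel (lam p) c ε K (e p z) := by
        filter_upwards [(hOo p hp).mem_nhds hxO] with z hz
        exact hFO p hp z hz
      have hD := fderiv_eq_zero_of_isMCriticalPt_of_eventuallyEq (he p hp) hxs hFsm hev hxc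
      have hex : e p x = 0 := eq_zero_of_fderiv_thinHandleModel_eq_zero hK0 hD
      have hxp : x = p := by
        obtain ⟨hps, hp0⟩ := hpe p hp
        rw [← (e p).left_inv hxs, hex, ← hp0, (e p).left_inv hps]
      exact hxP (hxp ▸ hp)
    · -- outside all chart balls: `F = f` near `x`
      push Not at hxB
      have hev : F =ᶠ[𝓝 x] f := by
        have hopen : IsOpen (⋃ p ∈ P, B p)ᶜ :=
          (isClosed_biUnion_finset fun p hp => (hBc p hp).1).isOpen_compl
        have hxU : x ∈ (⋃ p ∈ P, B p)ᶜ := fun h => by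
          obtain ⟨p, hp, hxp⟩ := mem_iUnion₂.1 h
          exact hxB p hp hxp
        filter_upwards [hopen.mem_nhds hxU] with z hz
        show f z - S z = f z
        rw [show S z = 0 from Finset.sum_eq_zero fun p hp => hT0 p hp z fun h =>
          hz (mem_iUnion₂.2 ⟨p, hp, h⟩), sub_zero]
      refine ⟨?_, hev.self_of_nhds⟩
      unfold IsMCriticalPt at hxc ⊢
      rwa [hev.mfderiv_eq] at hxc
  · -- (T5): transversality of the level sets of `F` to Milnor's field in the chart balls
    have hyt : y ∈ (e p).target := hball p hp hy
    have hzB : (e p).symm y ∈ B p := ⟨y, hy, rfl⟩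
    have hzO : (e p).symm y ∈ O p := hBO p hp hzB
    -- near `y`, `F ∘ e_p⁻¹` is the model
    have hev : (F ∘ (e p).symm) =ᶠ[𝓝 y] thinHandleModel (lam p) c ε K := by
      have hW : IsOpen ((e p).target ∩ (e p).symm ⁻¹' O p) :=
        (e p).continuousOn_symm.isOpen_inter_preimage (e p).open_target (hOo p hp)
      filter_upwards [hW.mem_nhds ⟨hyt, hzO⟩] with y' hy'
      simp only [Function.comp_apply]
      rw [hFO p hp _ hy'.2, (e p).right_inv hy'.1]
    rw [hev.fderiv_eq]
    exact fderiv_thinHandleModel_cone_pos hK0 y ha hb hab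
  · -- (T6): where `F = f`, the correction `S ≥ 0` vanishes, so `x` is a minimum of `S`
    have hSx : S x = 0 := by
      change f x - S x = f x at hx
      linarith
    have hmin : IsLocalMin S x :=
      Filter.Eventually.of_forall fun y => by rw [hSx]; exact hsum_nonneg y
    have hcrit : mfderiv (𝓡 n) 𝓘(ℝ, ℝ) S x = 0 :=
      isMCriticalPt_of_isLocalMin hmin BoundarylessManifold.isInteriorPoint
    have h1 : HasMFDerivAt (𝓡 n) 𝓘(ℝ, ℝ) f x (mfderiv (𝓡 n) 𝓘(ℝ, ℝ) f x) :=
      ((hf x).mdifferentiableAt (by simp)).hasMFDerivAt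
    have h2 : HasMFDerivAt (𝓡 n) 𝓘(ℝ, ℝ) S x (mfderiv (𝓡 n) 𝓘(ℝ, ℝ) S x) :=
      ((hSsm x).mdifferentiableAt (by simp)).hasMFDerivAt
    rw [hcrit] at h2
    have h3 := (h1.sub h2).congr_mfderiv (sub_zero _)
    exact h3.mfderiv

end Manifold

end Literature.Topology.FourManifolds

end
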